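import Summits.QuantumFields.YangMills.Theorems.SwapVirialDeficitZeroModeGroupThreeSmallBallScaling
import Summits.QuantumFields.YangMills.Theorems.SwapVirialDeficitZeroModeSigmaFourSmallBallCone
import HarnessLib

/-!
# Exact zero-mode rung, FOUR pairwise nearly commuting letters (`N₄(t)`, the `t⁶·log(1/t)` block of the periodic ring) — I: cone model, hub Tonelli
# and axis reduction
# (zero-mode block of crux ⟨stmt-QuantumFields-24497⟩ `ToronValleyVolume.ToronTubeVolumeLaw` — «exponent EXACTLY 6 with EXACTLY ONE logarithm»,
# two-sided ✓`ToronLog.haar_pi_nearlyCommuting_ge` / ✓`NearlyCommutingCeiling…le`; free-hands support of ⟨stmt-QuantumFields-24197⟩ / ⟨24497⟩)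

The four-letter twin of parts I–II of the three-letter chain (`…ZeroModeGroupThreeSmallBall{Cone,Scaling}`): for the event
`N₄(t) = nearlyCommuting t = {C : Fin 4 → SU(2) | ∀ μ ν, ‖q(C μ)q(C ν) − q(C ν)q(C μ)‖ ≤ t}` (✓`ToronLog.nearlyCommuting`),
* §1 `fourSet t a ⊆ (ℍ × ℍ) × ℍ` (the cone-model section at hub `a`: six `commSq ≤ t²`), `phiFour t a = coneThree (fourSet t a)` (w3 g63's
  ✓`ZeroModeSigma.coneThree`), `rescaledSet4 s a` (the section after the transverse blow-up `D_{√s}` of the three non-hub letters, multiplied out —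
  used in part II);
* §2 ★ `haar_nearlyCommuting_eq_lintegral_phiFour` — `Haar⁴(N₄(t)) = ∫ φ⁴_t(a) dcone(a)` (✓`ToronLog.measurePreserving_proj`, w3 g63's
  ✓`ZeroModeSigma.measurePreserving_arrange`, sections); ★ `phiFour_eq_axis` (conjugation invariance: `φ⁴_t(a) = φ⁴_t(re a + ‖Im a‖·i)`);
  ★ `haar_nearlyCommuting_eq_lintegral_axis`.
Part II (`…ZeroModeGroupFourSmallBallScaling`) factors the small-ball power out EXACTLY: `Haar⁴(N₄(t)) = t⁶·coneConst³·∫dcone(a) vol³(rescaledSet4 t² (axis a))`,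
so the logarithm of `N₄` lives entirely in the hub integral of a `t`-regular event.
HONEST LABEL: finite-dimensional measure theory on `SU(2)⁴` (plan-level zero-mode rung of DRAFT lines); NOT ⟨24497⟩, NOT ⟨24197⟩; the Yang–Mills mass gap
is NOT proved; no summit is proved by a line.  Seat ym-line-fcl-p3 g44 (cell ym-idea-1, free hands), `--supports stmt-QuantumFields-24197`.
Definitions + theorems, standard axioms.  References: [cite: GonzalezarroyoAltes1988]; [cite: Vanbaal2001]; [cite: Luscher1983, §2]; [folklore].
-/

set_option autoImplicit false

noncomputable section

open MeasureTheory Quaternion Set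
open scoped Quaternion ENNReal BigOperators
open Literature.MathematicalPhysics.QuantumLattice
open Literature.MathematicalPhysics.QuantumFieldTheory (haarProbability)
open Literature.MathematicalPhysics.QuantumFieldTheory.Balaban1983to89.T4HaarSU2Translate (su2Quat_quatToSU2 measurable_su2Quat)
open Summit.QuantumFields.YangMills.Theorems.SwapTwistDeficit.ToronLog
open Summit.QuantumFields.YangMills.Theorems.SwapVirialDeficit.ZeroModeSigma (arrange coneThree coneFour coneThree_def coneFour_def measurePreserving_arrange)
open Summit.QuantumFields.YangMills.Theorems.SwapVirialDeficit.ZeroModeSigma (ae_ne_zero_pi_four isProbabilityMeasure_coneThree isProbabilityMeasure_coneFour)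

attribute [local instance] Literature.Analysis.FluidPDE.Tao2016.quatMeasurableSpace
  Literature.Analysis.FluidPDE.Tao2016.quatBorelSpace
  Literature.MathematicalPhysics.QuantumLattice.secondCountableTopology_su2

namespace Summit.QuantumFields.YangMills.Theorems.SwapVirialDeficit.ZeroModeGroup

/-! ## §1 The events -/

/-- The cone-model section of `N₄(t)` at hub `a`, in w3 g63's coordinates `w = ((x, y), z)`: the six normalised commutators are `≤ t²`. [folklore] -/
def fourSet (t : ℝ) (a : ℍ) : Set ((ℍ × ℍ) × ℍ) :=
  {w | commSq w.1.1 w.1.2 ≤ t ^ 2 ∧ commSq w.1.1 w.2 ≤ t ^ 2 ∧ commSq w.1.2 w.2 ≤ t ^ 2 ∧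
    commSq w.1.1 a ≤ t ^ 2 ∧ commSq w.1.2 a ≤ t ^ 2 ∧ commSq w.2 a ≤ t ^ 2}

/-- Its `coneThree` mass `φ⁴_t(a)`. [folklore] -/
def phiFour (t : ℝ) (a : ℍ) : ℝ≥0∞ := coneThree (fourSet t a)

/-- ★ **The rescaled section** `G⁴_s(a)` (`s = t²`; multiplied out, no divisions): three balls `N_s < 1`, three hub constraints
`4a_I²(x_J²+x_K²) ≤ N_s(x)‖a‖²`, three coupled constraints `4[(x_Ky_I − x_Iy_K)² + (x_Iy_J − x_Jy_I)² + s(x_Jy_K − x_Ky_J)²] ≤ N_s(x)N_s(y)`. [folklore] -/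
def rescaledSet4 (s : ℝ) (a : ℍ) : Set ((ℍ × ℍ) × ℍ) :=
  {w | dilNormSq s w.1.1 < 1 ∧ dilNormSq s w.1.2 < 1 ∧ dilNormSq s w.2 < 1 ∧
    4 * (a.imI ^ 2 * (w.1.1.imJ ^ 2 + w.1.1.imK ^ 2)) ≤ dilNormSq s w.1.1 * ‖a‖ ^ 2 ∧
    4 * (a.imI ^ 2 * (w.1.2.imJ ^ 2 + w.1.2.imK ^ 2)) ≤ dilNormSq s w.1.2 * ‖a‖ ^ 2 ∧
    4 * (a.imI ^ 2 * (w.2.imJ ^ 2 + w.2.imK ^ 2)) ≤ dilNormSq s w.2 * ‖a‖ ^ 2 ∧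
    4 * ((w.1.1.imK * w.1.2.imI - w.1.1.imI * w.1.2.imK) ^ 2 + (w.1.1.imI * w.1.2.imJ - w.1.1.imJ * w.1.2.imI) ^ 2 +
        s * (w.1.1.imJ * w.1.2.imK - w.1.1.imK * w.1.2.imJ) ^ 2) ≤ dilNormSq s w.1.1 * dilNormSq s w.1.2 ∧
    4 * ((w.1.1.imK * w.2.imI - w.1.1.imI * w.2.imK) ^ 2 + (w.1.1.imI * w.2.imJ - w.1.1.imJ * w.2.imI) ^ 2 +
        s * (w.1.1.imJ * w.2.imK - w.1.1.imK * w.2.imJ) ^ 2) ≤ dilNormSq s w.1.1 * dilNormSq s w.2 ∧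
    4 * ((w.1.2.imK * w.2.imI - w.1.2.imI * w.2.imK) ^ 2 + (w.1.2.imI * w.2.imJ - w.1.2.imJ * w.2.imI) ^ 2 +
        s * (w.1.2.imJ * w.2.imK - w.1.2.imK * w.2.imJ) ^ 2) ≤ dilNormSq s w.1.2 * dilNormSq s w.2}

/-- The section `fourSet t a` is measurable. [folklore] -/
theorem measurableSet_fourSet (t : ℝ) (a : ℍ) : MeasurableSet (fourSet t a) := by
  have hx : Measurable fun w : (ℍ × ℍ) × ℍ => w.1.1 := measurable_fst.comp measurable_fst
  have hy : Measurable fun w : (ℍ × ℍ) × ℍ => w.1.2 := measurable_snd.comp measurable_fst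
  have hz : Measurable fun w : (ℍ × ℍ) × ℍ => w.2 := measurable_snd
  have hc : ∀ {f g : (ℍ × ℍ) × ℍ → ℍ}, Measurable f → Measurable g → Measurable fun w => commSq (f w) (g w) :=
    fun hf hg => measurable_commSq.comp (hf.prodMk hg)
  unfold fourSet
  exact (measurableSet_le (hc hx hy) measurable_const).inter ((measurableSet_le (hc hx hz) measurable_const).inter
    ((measurableSet_le (hc hy hz) measurable_const).inter ((measurableSet_le (hc hx measurable_const) measurable_const).inter
      ((measurableSet_le (hc hy measurable_const) measurable_const).inter (measurableSet_le (hc hz measurable_const) measurable_const)))))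

/-- The joint event `(a, w) ↦ [w ∈ fourSet t a]` is measurable on `ℍ × ((ℍ × ℍ) × ℍ)`. [folklore] -/
theorem measurableSet_fourSet_joint (t : ℝ) : MeasurableSet {q : ℍ × ((ℍ × ℍ) × ℍ) | q.2 ∈ fourSet t q.1} := by
  have ha : Measurable fun q : ℍ × ((ℍ × ℍ) × ℍ) => q.1 := measurable_fst
  have hx : Measurable fun q : ℍ × ((ℍ × ℍ) × ℍ) => q.2.1.1 := (measurable_fst.comp measurable_fst).comp measurable_snd
  have hy : Measurable fun q : ℍ × ((ℍ × ℍ) × ℍ) => q.2.1.2 := (measurable_snd.comp measurable_fst).comp measurable_snd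
  have hz : Measurable fun q : ℍ × ((ℍ × ℍ) × ℍ) => q.2.2 := measurable_snd.comp measurable_snd
  have hc : ∀ {f g : ℍ × ((ℍ × ℍ) × ℍ) → ℍ}, Measurable f → Measurable g → Measurable fun q => commSq (f q) (g q) :=
    fun hf hg => measurable_commSq.comp (hf.prodMk hg)
  simp only [fourSet, Set.mem_setOf_eq]
  exact (measurableSet_le (hc hx hy) measurable_const).inter ((measurableSet_le (hc hx hz) measurable_const).inter
    ((measurableSet_le (hc hy hz) measurable_const).inter ((measurableSet_le (hc hx ha) measurable_const).inter
      ((measurableSet_le (hc hy ha) measurable_const).inter (measurableSet_le (hc hz ha) measurable_const)))))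

/-! ## §2 Haar⁴ to the cone model, hub Tonelli, axis reduction -/

/-- ★ **Hub Tonelli**: `Haar⁴(N₄(t)) = ∫ φ⁴_t(a) dcone(a)` (`t ≥ 0`), the hub being letter `3` in w3 g63's arrangement `(v 3, ((v 0, v 2), v 1))`. [folklore] -/
theorem haar_nearlyCommuting_eq_lintegral_phiFour {t : ℝ} (ht : 0 ≤ t) :
    (Measure.pi fun _ : Fin 4 => haarProbability (Matrix.specialUnitaryGroup (Fin 2) ℂ)) (nearlyCommuting t) = ∫⁻ a, phiFour t a ∂coneMeasure := by
  haveI := isProbabilityMeasure_coneMeasure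
  haveI := isProbabilityMeasure_coneThree
  -- Haar⁴ → cone⁴
  have hNm : MeasurableSet (nearlyCommuting t) := by
    have hq : ∀ μ : Fin 4, Measurable fun C : Fin 4 → Matrix.specialUnitaryGroup (Fin 2) ℂ => su2Quat (C μ) :=
      fun μ => measurable_su2Quat.comp (measurable_pi_apply μ)
    have e : nearlyCommuting t = ⋂ μ : Fin 4, ⋂ ν : Fin 4, {C : Fin 4 → Matrix.specialUnitaryGroup (Fin 2) ℂ |
        ‖su2Quat (C μ) * su2Quat (C ν) - su2Quat (C ν) * su2Quat (C μ)‖ ≤ t} := by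
      ext C; simp [nearlyCommuting]
    rw [e]
    exact MeasurableSet.iInter fun μ => MeasurableSet.iInter fun ν =>
      measurableSet_le (((hq μ).mul (hq ν)).sub ((hq ν).mul (hq μ))).norm measurable_const
  set S : Set (ℍ × ((ℍ × ℍ) × ℍ)) := {q | q.2 ∈ fourSet t q.1} with hS
  have hSm : MeasurableSet S := measurableSet_fourSet_joint t
  have hcone : (Measure.pi fun _ : Fin 4 => haarProbability (Matrix.specialUnitaryGroup (Fin 2) ℂ)) (nearlyCommuting t) =
      (Measure.pi fun _ : Fin 4 => coneMeasure) (arrange ⁻¹' S) := by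
    rw [← measurePreserving_proj.measure_preimage hNm.nullMeasurableSet]
    refine measure_congr ?_
    filter_upwards [ae_ne_zero_pi_four] with v hv
    simp only [eq_iff_iff]
    change (fun μ => quatToSU2 (v μ)) ∈ nearlyCommuting t ↔ v ∈ arrange ⁻¹' S
    simp only [nearlyCommuting, Set.mem_setOf_eq, Set.mem_preimage, hS, arrange, fourSet]
    have key : ∀ μ ν : Fin 4, ‖su2Quat (quatToSU2 (v μ)) * su2Quat (quatToSU2 (v ν)) - su2Quat (quatToSU2 (v ν)) * su2Quat (quatToSU2 (v μ))‖ ≤ t ↔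
        commSq (v μ) (v ν) ≤ t ^ 2 := fun μ ν => by
      rw [norm_le_iff_sq_le ht, norm_comm_su2Quat_quatToSU2_sq (hv μ) (hv ν)]
    simp only [key]
    constructor
    · intro h
      exact ⟨h 0 2, h 0 1, h 2 1, h 0 3, h 2 3, h 1 3⟩
    · rintro ⟨h02, h01, h21, h03, h23, h13⟩ μ ν
      have hsymm : ∀ μ ν : Fin 4, commSq (v μ) (v ν) = commSq (v ν) (v μ) := fun μ ν => commSq_comm _ _
      have hdiag : ∀ μ : Fin 4, commSq (v μ) (v μ) ≤ t ^ 2 := fun μ => by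
        rw [commSq_def, sub_self, norm_zero]; simp [sq_nonneg]
      fin_cases μ <;> fin_cases ν
      all_goals first
        | exact hdiag _ | exact h02 | exact h01 | exact h21 | exact h03 | exact h23 | exact h13
        | (rw [hsymm]; first | exact h02 | exact h01 | exact h21 | exact h03 | exact h23 | exact h13)
  rw [hcone, measurePreserving_arrange.measure_preimage hSm.nullMeasurableSet, coneFour_def, Measure.prod_apply hSm]
  rfl

/-- Simultaneous conjugation of the three letters preserves `coneThree`. [folklore] -/
theorem measurePreserving_conjIso_three (u : ℍ) (hu : ‖u‖ = 1) :
    MeasurePreserving (Prod.map (Prod.map (conjIso u hu) (conjIso u hu)) (conjIso u hu)) coneThree coneThree := by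
  haveI := isProbabilityMeasure_coneMeasure
  rw [coneThree_def]
  exact ((measurePreserving_conjIso_cone u hu).prod (measurePreserving_conjIso_cone u hu)).prod (measurePreserving_conjIso_cone u hu)

/-- ★ **`φ⁴_t(a) = φ⁴_t(axisPoint a)`** whenever `q(a) ≠ 0` (rotate the three letters by the straightening conjugation). [folklore] -/
theorem phiFour_eq_axis (t : ℝ) {a : ℍ} (ha : coneQ a ≠ 0) : phiFour t a = phiFour t (axisPoint a) := by
  set u : ℍ := ‖coneQ a‖⁻¹ • coneQ a with hu_def
  have hu : ‖u‖ = 1 := norm_unitConeQ ha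
  have hP := measurePreserving_conjIso_three u hu
  have hpre : fourSet t a = (Prod.map (Prod.map (conjIso u hu) (conjIso u hu)) (conjIso u hu)) ⁻¹' fourSet t (axisPoint a) := by
    ext w
    simp only [fourSet, Set.mem_setOf_eq, Set.mem_preimage, Prod.map_fst, Prod.map_snd, conjIso_apply]
    rw [← conj_unitConeQ_self ha, commSq_conj hu, commSq_conj hu, commSq_conj hu, commSq_conj hu, commSq_conj hu, commSq_conj hu]
  rw [phiFour, phiFour, hpre, hP.measure_preimage (measurableSet_fourSet t _).nullMeasurableSet]

/-- ★ **`Haar⁴(N₄(t)) = ∫ φ⁴_t(re a + ‖Im a‖·i) dcone(a)`** (`t ≥ 0`). [folklore] -/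
theorem haar_nearlyCommuting_eq_lintegral_axis {t : ℝ} (ht : 0 ≤ t) :
    (Measure.pi fun _ : Fin 4 => haarProbability (Matrix.specialUnitaryGroup (Fin 2) ℂ)) (nearlyCommuting t) =
      ∫⁻ a, phiFour t (axisPoint a) ∂coneMeasure := by
  rw [haar_nearlyCommuting_eq_lintegral_phiFour ht]
  refine lintegral_congr_ae ?_
  filter_upwards [ae_coneQ_ne_zero] with a ha using phiFour_eq_axis t ha

end Summit.QuantumFields.YangMills.Theorems.SwapVirialDeficit.ZeroModeGroup

end
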